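import Mathlib
import Summits.NavierStokesRegularity.NavierStokesRegularity.Theorems.TaoLadderRungTwoBreakOneShiftWindowK1LinkD
import Summits.NavierStokesRegularity.NavierStokesRegularity.Theorems.TaoLadderRungTwoBreakOneShiftWindowTailCentre
import HarnessLib

/-!
# The one-shift window system, LII: THE CENTRE RESIDUAL IN DYADIC INTERVAL ARITHMETIC — the data and the ONE Boolean that
# discharge the finite check `hY` of part XII `K3_of_centreRun` (interval evaluation of `resFormula z Ttop ŷ` over a hull
# `Zc` of the centre run at the flight-time centre and the top tube, preconditioned rows `|Σ_{r'} C_{rr'} G_{r'}| ≤ Y · S_r`,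
# division-free), reusing the Krawczyk datum of part XLII for `C`, the scales and the frame combinatorics (cell
# harvest/h2-tao-ladder, seat p2; rung1/KERNEL-CHEAP-REPLAY-SPEC.md §2 (Krawczyk file: Gc := G(z_C ± D_C), b := C·Gc/s), §6 (ii);
# support for K1(1) = `NoSurvivingDSSOne`, stmt-NavierStokesRegularity-20205)

MODEL lattice ODEs only (Tao 2016 §4 normal form on Tao's shift set `S`); nothing here is a statement about
the Navier–Stokes equations; no item is closed; no instance is evaluated here.

* `K3D` = a `KrawD` + the centre hull `Zc` (flat), the range `Gc` of `g` over it, boxes `ycB ∋ ŷ`, `strigB ∋ strig`, the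
  final-step time interval `TI ∋ τc − t_S`, the bound `YD`; `energyC`, `resBox`, `rowval`, `check`;
* `K3D.hY_of_check` — the hypothesis `hY` of `K3_of_centreRun` with `zlo/zhi` read from `Zc`, `Cmat = CmatR`, `Y = YD`.
-/

noncomputable section

-- the sub-problem namespace repeats the summit name by design (D-0017)
set_option linter.dupNamespace false

namespace Summit.NavierStokesRegularity.NavierStokesRegularity.Theorems

namespace DSSOneShift

open Set Finset
open Literature.Analysis.FluidPDE Literature.Analysis.FluidPDE.TaoCascade
open Summit.NavierStokesRegularity.NavierStokesRegularity.Theorems.TaylorModelCert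
open Summit.NavierStokesRegularity.NavierStokesRegularity.Theorems.CertificateGlueOn

/-! ### Data and the Boolean -/

/-- **The dyadic data of the centre-residual test.** [cite: Tao2016AveragedNS, §5.3; cell vocabulary, harvest/h2-tao-ladder rung1/KERNEL-CHEAP-REPLAY-SPEC.md §2 (Krawczyk file)] -/
structure K3D where
  /-- the Krawczyk datum (preconditioner, scales, frame combinatorics, top tube) -/
  kd : KrawD
  /-- hull of the centre run at the flight-time centre (flat) -/
  Zc : Array IntervalD
  /-- range of the renormalisation factor over that hull -/
  Gc : IntervalD
  /-- boxes of the box centre `ŷ` (flat) -/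
  ycB : Array IntervalD
  /-- box of the section level -/
  strigB : IntervalD
  /-- time interval of the final step containing `τc − t_S` -/
  TI : IntervalD
  /-- the bound `Y` of (K3) -/
  YD : Dyad

namespace K3D

variable (k : K3D)

/-- The shell-1 energy box of the centre hull. [folklore] -/
def energyC : IntervalD :=
  IntervalD.rangeSumR k.kd.rs.prec (fun i => IntervalD.sqrR k.kd.rs.prec (IntervalD.aget k.Zc (ResSlopeD.natget k.kd.rs.idx1 i)))
    k.kd.rs.nm

/-- The residual box of block coordinate `r` (`r = n`: the section row). [cite: Tao2016AveragedNS, §5.3; cell vocabulary, harvest/h2-tao-ladder rung1/STAGE2-LEMMA.md §2 (G)] -/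
def resBox (r : ℕ) : IntervalD :=
  if r = k.kd.rs.n then
    IntervalD.subR k.kd.rs.prec
      (IntervalD.mulR k.kd.rs.prec ResSlopeD.halfI
        (IntervalD.rangeSumR k.kd.rs.prec
          (fun i => IntervalD.sqrR k.kd.rs.prec (IntervalD.aget k.Zc (ResSlopeD.natget k.kd.rs.idxD i))) k.kd.rs.nm))
      k.strigB
  else
    IntervalD.subR k.kd.rs.prec
      (match ResSlopeD.optget k.kd.rs.succ r with
        | some s => IntervalD.mulR k.kd.rs.prec k.Gc (IntervalD.aget k.Zc s)
        | none => IntervalD.mulR k.kd.rs.prec k.Gc (IntervalD.aget k.kd.rs.Ttop (ResSlopeD.natget k.kd.rs.mode r)))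
      (IntervalD.aget k.ycB r)

/-- The preconditioned row `Σ_{r'} C_{rr'} ⊗ resBox_{r'}`. [folklore] -/
def rowval (r : ℕ) : IntervalD :=
  IntervalD.rangeSumR k.kd.rs.prec (fun r' => IntervalD.mulR k.kd.rs.prec (IntervalD.ofDyad (k.kd.cget r r')) (k.resBox r')) k.kd.N1

/-- **THE CENTRE-RESIDUAL TEST**: positive centre energy, the square certificate of `Gc`, `0 ≤ Y`, and per block row
`S_r.lo > 0 ∧ mag(rowval r) ≤ Y · S_r.lo`. [cite: Tao2016AveragedNS, §5.3; cell vocabulary, harvest/h2-tao-ladder rung1/STAGE2-LEMMA.md §3 (‖C G(x̂)‖ ≤ Y)] -/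
def check : Bool :=
  Dyad.blt (Dyad.ofInt 0) k.energyC.lo && gCert k.energyC.lo k.energyC.hi k.Gc && Dyad.ble (Dyad.ofInt 0) k.YD &&
    (List.range k.kd.N1).all fun r =>
      Dyad.blt (Dyad.ofInt 0) (k.kd.Sbox r).lo && Dyad.ble (IntervalD.mag (k.rowval r)) (k.YD.mul (k.kd.Sbox r).lo)

/-! ### Soundness -/

section Sound

variable {m : ℕ} (F : OneShiftFrame m) (e : Fin m × Fin F.W ≃ Fin k.kd.rs.n)

/-- The hull bounds on the window, read through the numbering (junk `0` off the window). [folklore] -/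
def zlo (i : Fin m) (kk : ℤ) : ℝ := if h : F.InWindow kk then (IntervalD.aget k.Zc (e (i, F.widx h))).lo.toReal else 0

/-- The hull bounds on the window, read through the numbering (junk `0` off the window). [folklore] -/
def zhi (i : Fin m) (kk : ℤ) : ℝ := if h : F.InWindow kk then (IntervalD.aget k.Zc (e (i, F.widx h))).hi.toReal else 0

variable {F e}

/-- **SOUNDNESS OF THE CENTRE-RESIDUAL TEST**: the hypothesis `hY` of part XII `K3_of_centreRun` with the hull `[zlo, zhi]`,
`Cmat = CmatR` and `Y = YD`. [cite: Tao2016AveragedNS, §5.3; Moore1979, §3.2; cell vocabulary, harvest/h2-tao-ladder rung1/KERNEL-CHEAP-REPLAY-SPEC.md §2 (Krawczyk file)] -/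
theorem hY_of_check (hW1 : 1 < F.W) (hDW : F.D < F.W) (hm : k.kd.rs.nm = m)
    (hsucc : ∀ i (j : Fin F.W), ResSlopeD.optget k.kd.rs.succ (e (i, j)) =
      if h : (j : ℕ) + 1 < F.W then some ((e (i, ⟨(j : ℕ) + 1, h⟩)) : ℕ) else none)
    (hmode : ∀ i (j : Fin F.W), ResSlopeD.natget k.kd.rs.mode (e (i, j)) = (i : ℕ))
    (hidx1 : ∀ i : Fin m, ResSlopeD.natget k.kd.rs.idx1 i = (e (i, ⟨1, hW1⟩) : ℕ))
    (hidxD : ∀ i : Fin m, ResSlopeD.natget k.kd.rs.idxD i = (e (i, ⟨F.D, hDW⟩) : ℕ))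
    (ha : ∀ i (j : Fin F.W), IntervalD.mem (F.a i ((j : ℕ) : ℤ)) (IntervalD.aget k.kd.rs.aBox (e (i, j))))
    (hrτ : IntervalD.mem F.rτ k.kd.rs.rtau)
    (hTtop : ∀ (i : Fin m) (x : ℝ), |x - F.tubeC i F.W| ≤ F.tubeR F.W → IntervalD.mem x (IntervalD.aget k.kd.rs.Ttop i))
    (hyc : ∀ i (j : Fin F.W), IntervalD.mem (F.yc i ((j : ℕ) : ℤ)) (IntervalD.aget k.ycB (e (i, j))))
    (hstrig : IntervalD.mem F.strig k.strigB) (hc : k.check = true) :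
    ∀ (z : Fin m → ℤ → ℝ) (Ttop : Fin m → ℝ),
      (∀ i kk, F.InWindow kk → k.zlo F e i kk ≤ z i kk ∧ z i kk ≤ k.zhi F e i kk) →
      (∀ i, |Ttop i - F.tubeC i F.W| ≤ F.tubeR F.W) →
      ∀ r, |(∑ r', k.kd.CmatR F e r r' * F.coord (F.resFormula z Ttop F.yc) r') / F.bscale r| ≤ k.YD.toReal := by
  classical
  -- unpack
  unfold check at hc
  simp only [Bool.and_eq_true, List.all_eq_true, List.mem_range] at hc
  obtain ⟨⟨⟨he0, hG⟩, hY0⟩, hrows⟩ := hc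
  have he0' : 0 < k.energyC.lo.toReal := by simpa using (Dyad.blt_iff _ _).1 he0
  have hY0' : 0 ≤ k.YD.toReal := by simpa using (Dyad.ble_iff _ _).1 hY0
  intro z Ttop hz hT r
  -- window values in `Zc`
  have hzc : ∀ i (j : Fin F.W), IntervalD.mem (z i ((j : ℕ) : ℤ)) (IntervalD.aget k.Zc (e (i, j))) := by
    intro i j
    have hk : F.InWindow ((j : ℕ) : ℤ) := F.inWindow_natCast j
    have h := hz i _ hk
    simp only [zlo, zhi, dif_pos hk, F.widx_natCast j hk] at h
    exact h
  -- the renormalisation factor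
  have hE : IntervalD.mem (∑ i, z i 1 ^ 2) k.energyC := by
    unfold energyC
    rw [hm]
    refine mem_sum_equiv (Equiv.refl (Fin m)) k.kd.rs.prec fun i hi => ?_
    simp only [Equiv.refl_symm, Equiv.refl_apply]
    rw [hidx1 ⟨i, hi⟩]
    exact IntervalD.mem_sqrR k.kd.rs.prec (by simpa using hzc ⟨i, hi⟩ ⟨1, hW1⟩)
  have hg : IntervalD.mem (gfac z) k.Gc := by
    unfold gfac; exact mem_rsqrt_of_gCert hG he0' ⟨hE.1, hE.2⟩
  -- every residual coordinate in its box
  have hne : ∀ p : Fin m × Fin F.W, ((e p : ℕ) = k.kd.rs.n) = False := fun p => by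
    simp only [eq_iff_iff, iff_false]; exact (e p).isLt.ne
  have hres : ∀ r', IntervalD.mem (F.coord (F.resFormula z Ttop F.yc) r') (k.resBox (k.kd.rs.eO F e r')) := by
    intro r'
    rcases r' with _ | ⟨i, j⟩
    · -- section row
      simp only [OneShiftFrame.coord_none, OneShiftFrame.resFormula, ResSlopeD.eO, Option.elim, resBox, if_true, shellEnergy]
      refine IntervalD.mem_subR k.kd.rs.prec ?_ hstrig
      have hhalf : IntervalD.mem (1 / 2 : ℝ) ResSlopeD.halfI := by
        have := IntervalD.mem_ofDyad (⟨1, -1⟩ : Dyad)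
        simp only [Dyad.toReal] at this
        norm_num at this ⊢
        exact this
      refine IntervalD.mem_mulR k.kd.rs.prec hhalf ?_
      rw [hm]
      refine mem_sum_equiv (Equiv.refl (Fin m)) k.kd.rs.prec fun i hi => ?_
      simp only [Equiv.refl_symm, Equiv.refl_apply]
      rw [hidxD ⟨i, hi⟩]
      exact IntervalD.mem_sqrR k.kd.rs.prec (hzc ⟨i, hi⟩ ⟨F.D, hDW⟩)
    · simp only [OneShiftFrame.coord_some, OneShiftFrame.resFormula, ResSlopeD.eO, Option.elim, resBox, hne (i, j), if_false]
      by_cases hj : (j : ℕ) + 1 < F.W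
      · have hs := hsucc i j
        rw [dif_pos hj] at hs
        rw [hs]
        have hjz : ((j : ℕ) : ℤ) + 1 < F.W := by exact_mod_cast hj
        simp only [if_pos hjz]
        have h1 := hzc i ⟨(j : ℕ) + 1, hj⟩
        simp only [Nat.cast_add, Nat.cast_one] at h1
        exact IntervalD.mem_subR k.kd.rs.prec (IntervalD.mem_mulR k.kd.rs.prec hg h1) (hyc i j)
      · have hs := hsucc i j
        rw [dif_neg hj] at hs
        rw [hs]
        have hjz : ¬ ((j : ℕ) : ℤ) + 1 < F.W := by exact_mod_cast hj
        simp only [if_neg hjz, hmode i j]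
        exact IntervalD.mem_subR k.kd.rs.prec (IntervalD.mem_mulR k.kd.rs.prec hg (hTtop i _ (hT i))) (hyc i j)
  -- the preconditioned row
  have hrow : IntervalD.mem (∑ r', k.kd.CmatR F e r r' * F.coord (F.resFormula z Ttop F.yc) r') (k.rowval (k.kd.rs.eO F e r)) := by
    unfold rowval KrawD.CmatR
    have hN1 : k.kd.N1 = k.kd.rs.n + 1 := rfl
    rw [hN1]
    refine mem_sum_equiv (k.kd.eOE F e) k.kd.rs.prec fun j hj => ?_
    have hval : k.kd.rs.eO F e ((k.kd.eOE F e).symm ⟨j, hj⟩) = j := by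
      have := k.kd.eOE_val F e ((k.kd.eOE F e).symm ⟨j, hj⟩)
      rw [Equiv.apply_symm_apply] at this
      exact this.symm
    have h1 := hres ((k.kd.eOE F e).symm ⟨j, hj⟩)
    rw [hval] at h1
    rw [hval]
    exact IntervalD.mem_mulR k.kd.rs.prec (IntervalD.mem_ofDyad _) h1
  -- the block scale
  have hS := F.bscale_pos r
  have hSmem : IntervalD.mem (F.bscale r) (k.kd.Sbox (k.kd.rs.eO F e r)) := by
    rcases r with _ | ⟨i, j⟩
    · simp only [OneShiftFrame.bscale, Option.elim, KrawD.Sbox, ResSlopeD.eO, if_true]; exact hrτ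
    · simp only [OneShiftFrame.bscale, Option.elim, KrawD.Sbox, ResSlopeD.eO]
      rw [if_neg (e (i, j)).isLt.ne]
      exact ha i j
  have hr := (k.kd.eOE F e r).isLt
  rw [KrawD.eOE_val] at hr
  obtain ⟨hSlo, hle⟩ := hrows _ hr
  have hSlo' : 0 < (k.kd.Sbox (k.kd.rs.eO F e r)).lo.toReal := by simpa using (Dyad.blt_iff _ _).1 hSlo
  have hmag : |∑ r', k.kd.CmatR F e r r' * F.coord (F.resFormula z Ttop F.yc) r'| ≤
      k.YD.toReal * (k.kd.Sbox (k.kd.rs.eO F e r)).lo.toReal := by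
    have h1 := IntervalD.abs_le_mag hrow
    have h2 := (Dyad.ble_iff _ _).1 hle
    rw [Dyad.toReal_mul] at h2
    exact h1.trans h2
  rw [abs_div, abs_of_pos hS, div_le_iff₀ hS]
  exact hmag.trans (mul_le_mul_of_nonneg_left hSmem.1 hY0')

end Sound

end K3D

end DSSOneShift

end Summit.NavierStokesRegularity.NavierStokesRegularity.Theorems
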